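/-
Copyright (c) 2026. All rights reserved.
Released under Apache 2.0 license as described in the file LICENSE.
Authors: abc-iut cell, prover seat abc-iut-L4-d2 (gen 9).
-/
import Literature.AnabelianGeometry.AbsoluteAnabelian.GaloisTheatersNumberFieldShadowAutRel
import Literature.AnabelianGeometry.AbsoluteAnabelian.GaloisTheatersNumberFieldShadowTFPairsModel
import Literature.AnabelianGeometry.AbsoluteAnabelian.GaloisTheatersNumberFieldShadowTFPairsCor52iii
import Literature.AnabelianGeometry.AbsoluteAnabelian.GaloisTheatersNumberFieldShadowTFPairsCor52iv
import Literature.AnabelianGeometry.AbsoluteAnabelian.PanalocalTPairs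
import HarnessLib

/-!
# [AbsTopIII] Def 5.1 (vi) / Cor 5.2 (vi), object part (F-3085 `PanalocalTPairExists`) PROVED at the `TF`-shadow
# vocabularies over the number-field shadow context

S. Mochizuki, *Topics in absolute anabelian geometry III* [MochizukiAbsTopIII2015], Def 5.1 (iv) p. 116 (gloss: the groups
of a panalocal Galois-theater are the decomposition groups of the lifts `ṽ` of `v`, considered up to automorphisms as `ṽ`
ranges over the lifts), Def 5.1 (vi) p. 118 ("we obtain a natural “panalocalization functor” `Th⊚_T → Th✠_T`"), Cor 5.2 (vi)
p. 120 (gloss: the objects `M✠_T(Π) := (Π, {M⊚_T(Π)}✠)` of `An⊚[Th✠_T]`, "we use the notation “`{−}✠`” to denote the data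
obtained by applying the panalocalization functor `Th⊚ → Th✠` of Definition 5.1, (vi)").

The cell typed the panalocalization of global `T`-pairs as the RELATION `PanalocalTPair.IsPanalocalizationOf` and its object
part as the named fact `PanalocalTPairExists W` (F-3085; `PanalocalTPairs.lean`, abc-iut-L4-t3), so far witnessed only at the
degenerate model (p427778).  THIS PROOF-ONLY FILE proves it over the number-field shadow context `NumberFieldShadow.context F`
at EVERY `TF`-shadow vocabulary `{ fieldShadowVocabulary F with IsMLFGaloisPair := P }` — the construction never reads the
MLF-Galois-pair predicate — in particular at `fieldShadowVocabulary F` (p491073, group-theoretic predicate) and at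
`fieldShadowVocabulary' F` (p493095, print-shape predicate):

* inputs BY NAME from `GaloisTheatersNumberFieldShadowAutRel.lean` (abc-iut-L4-d2 g9): two local elements with the same
  class in `V⊚(Π_E)/Aut(Π_E)` differ by ONE `EA⊚`-automorphism `α` (`exists_iso_mapProVal_eq_of_toModAut_eq`); the embeddings
  under `v` and `τ • v` correspond under `τ` up to a field automorphism `C ∈ {id, conj}` of `ℂ` (`exists_ringEquiv_contextKappa_smul`);
* `exists_decompGrpIso_actIso_of_mapProVal_eq` / `exists_archIso_kummerIso_of_mapProVal_eq` — TRANSPORT of the local data of a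
  global `TF`-pair between `Aut(Π_E)`-conjugate local elements `v`, `w = V⊚(α)(v) = τ_α • v`: the pair isomorphism is
  `ψ_v⁻¹ ≫ (τ_α ·) ≫ ψ_w` along `g ↦ α(g)` on decomposition groups (reference condition (b) of Def 5.1 (v) and the
  chart-transition law `ratChart ∘ α = τ_α · ratChart · τ_α⁻¹`), resp. — archimedean — along the orbispace isomorphism
  `j_v⁻¹ ≫ C ≫ j_w` (reference condition (c));
* **`panalocalTPairExists_fieldShadowWith` (F-3085)**: the panalocalization `{M⊚}✠` of a global `TF`-pair `M⊚` — underlying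
  panalocal Galois-theater `V⊚(Π_E)/Aut(Π_E)` with, at each class, the decomposition group / orbispace / local `TF`-pair data OF
  `M⊚` AT A CHOSEN LIFT, identified with the data of `M⊚` at every other lift by the transport lemmas; corollaries
  `panalocalTPairExists_fieldShadow`, `panalocalTPairExists_fieldShadow'`.

HONEST LABEL: shadow (`Δ = 1`), algebraic parts of the completions, stub cyclotomes, STUB Aut-holomorphic orbispaces (the
orbispace isomorphisms are representatives with a free `fieldIso`, as labelled G1/T2 in `GaloisTheaters.lean`); NOT the genuine
`(R, W)` of an elliptically admissible curve (E-L4-13), where the row stays an assumption.  No `def`/`instance`/`structure`;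
nothing here bears on [IUTchIII] Cor. 3.12 or takes a side; typed ≠ proved.
-/

noncomputable section

open scoped Pointwise Topology
open CategoryTheory NumberField Field

namespace Literature.AnabelianGeometry.AbsoluteAnabelian

namespace NumberFieldShadow

variable (F : Type) [Field F] [NumberField F]

/-! ### Transport of the local data of a global `TF`-pair between `Aut(Π)`-conjugate local elements -/

/-- **Nonarchimedean transport.**  For a global Galois-theater `V⊚` over the shadow with reference isomorphism `ψ_V`, local
`TF`-data `(Π_v ↷ M_v)` with reference isomorphisms `ψ_v : ℚ̄ ⥲ M_{ψ_V(v)}` satisfying condition (b) of Def 5.1 (v), and an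
`EA⊚`-automorphism `α` of `Π` with `V⊚(α)(v) = w`: the pairs at `ψ_V(v)` and `ψ_V(w)` are isomorphic along `g ↦ α(g)` — through
`ψ_v⁻¹ ≫ (τ_α ·) ≫ ψ_w`, by the chart-transition law `ratChart ∘ α = τ_α · ratChart · τ_α⁻¹`.
[cite: MochizukiAbsTopIII2015, Def 5.1 (vi) p.118] -/
theorem exists_decompGrpIso_actIso_of_mapProVal_eq (T₀ : GlobalGaloisTheater (context F))
    (ψV : ((context F).proVal T₀.ext).carrier ≃ₜ T₀.V.carrier) (hψV : T₀.IsReferenceIso ψV)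
    (hnon : ∀ v : ((context F).proVal T₀.ext).non, ψV v ∈ T₀.V.non)
    (Mnon : T₀.V.non → CommRingCat.{0}) (actNon : ∀ v : T₀.V.non, T₀.V.decompGrp (v : T₀.V.carrier) →* Aut (Mnon v))
    (ψnon : ∀ v : ((context F).proVal T₀.ext).non, (CommRingCat.of (AlgebraicClosure ℚ) : CommRingCat.{0}) ≅ Mnon ⟨ψV v, hnon v⟩)
    (hb : ∀ (v : ((context F).proVal T₀.ext).non) (g : T₀.grp)
      (hg : g ∈ ((context F).proVal T₀.ext).decomp (v : ((context F).proVal T₀.ext).carrier))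
      (hg' : g ∈ T₀.V.decomp (ψV v)),
      (fieldLocAct T₀.ext v.1 ⟨g, hg⟩).hom ≫ (ψnon v).hom = (ψnon v).hom ≫ (actNon ⟨ψV v, hnon v⟩ ⟨g, hg'⟩).hom)
    (α : T₀.ext ≅ T₀.ext) (hα : IsEAHom α.hom) (v w : ((context F).proVal T₀.ext).carrier)
    (hvw : (context F).mapProVal α.hom hα v = w) (hv : ψV v ∈ T₀.V.non) (hw : ψV w ∈ T₀.V.non) :
    ∃ (e : T₀.V.decompGrp (ψV v) ≃ₜ* T₀.V.decompGrp (ψV w)) (φ : Mnon ⟨ψV v, hv⟩ ≅ Mnon ⟨ψV w, hw⟩),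
      ∀ g, (actNon ⟨ψV v, hv⟩ g).hom ≫ φ.hom = φ.hom ≫ (actNon ⟨ψV w, hw⟩ (e g)).hom := by
  have hdec : ∀ u : ((context F).proVal T₀.ext).carrier,
      ((context F).proVal T₀.ext).decomp u = T₀.V.decomp (ψV u) := fun u => by
    ext g
    simp only [GaloisProSet.decomp, MulAction.mem_stabilizer_iff]
    rw [← hψV.1, ψV.injective.eq_iff]
  have hnon_of : ∀ {u : ((context F).proVal T₀.ext).carrier}, ψV u ∈ T₀.V.non →
      u ∈ ((context F).proVal T₀.ext).non := fun {u} hu => by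
    have h : ψV u ∈ ψV '' ((context F).proVal T₀.ext).non := by rw [hψV.2.2.1]; exact hu
    obtain ⟨u', hu', he⟩ := h
    rwa [← ψV.injective he]
  have hvn : v ∈ ((context F).proVal T₀.ext).non := hnon_of hv
  have hwn : w ∈ ((context F).proVal T₀.ext).non := hnon_of hw
  -- `α` carries `Π_v` onto `Π_w`
  have hmem : ∀ g : T₀.ext.arith, g ∈ T₀.V.decomp (ψV v) ↔ α.hom.arith g ∈ T₀.V.decomp (ψV w) := by
    intro g
    rw [← hdec v, ← hdec w, ← hvw]
    exact (GlobalAnabelianContext.mem_decomp_mapProVal_iff α.hom hα v g).symm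
  have hinv : ∀ g, α.inv.arith (α.hom.arith g) = g := AbsTopI.iso_inv_hom_arith α
  have hinv' : ∀ h, α.hom.arith (α.inv.arith h) = h := AbsTopI.iso_hom_inv_arith α
  let e : T₀.V.decompGrp (ψV v) ≃ₜ* T₀.V.decompGrp (ψV w) :=
    { toFun := fun g => ⟨α.hom.arith g.1, (hmem g.1).mp g.2⟩
      invFun := fun h => ⟨α.inv.arith h.1, (hmem _).mpr (by rw [hinv']; exact h.2)⟩
      left_inv := fun g => Subtype.ext (hinv g.1)
      right_inv := fun h => Subtype.ext (hinv' h.1)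
      map_mul' := fun a b => Subtype.ext (map_mul α.hom.arith a.1 b.1)
      continuous_toFun := (α.hom.arith.continuous.comp continuous_subtype_val).subtype_mk _
      continuous_invFun := (α.inv.arith.continuous.comp continuous_subtype_val).subtype_mk _ }
  -- `φ := ψ_v⁻¹ ≫ (τ_α ·) ≫ ψ_w`
  let τ : absoluteGaloisGroup ℚ := conjugator α.hom hα
  let ψv : (CommRingCat.of (AlgebraicClosure ℚ) : CommRingCat.{0}) ≅ Mnon ⟨ψV v, hv⟩ := ψnon ⟨v, hvn⟩
  let ψw : (CommRingCat.of (AlgebraicClosure ℚ) : CommRingCat.{0}) ≅ Mnon ⟨ψV w, hw⟩ := ψnon ⟨w, hwn⟩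
  have hbv : ∀ (g : T₀.ext.arith) (hg : g ∈ ((context F).proVal T₀.ext).decomp v) (hg' : g ∈ T₀.V.decomp (ψV v)),
      (fieldLocAct T₀.ext v ⟨g, hg⟩).hom ≫ ψv.hom = ψv.hom ≫ (actNon ⟨ψV v, hv⟩ ⟨g, hg'⟩).hom :=
    fun g hg hg' => hb ⟨v, hvn⟩ g hg hg'
  have hbw : ∀ (g : T₀.ext.arith) (hg : g ∈ ((context F).proVal T₀.ext).decomp w) (hg' : g ∈ T₀.V.decomp (ψV w)),
      (fieldLocAct T₀.ext w ⟨g, hg⟩).hom ≫ ψw.hom = ψw.hom ≫ (actNon ⟨ψV w, hw⟩ ⟨g, hg'⟩).hom :=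
    fun g hg hg' => hb ⟨w, hwn⟩ g hg hg'
  refine ⟨e, ψv.symm ≪≫ fieldAutHom τ ≪≫ ψw, fun g => ?_⟩
  obtain ⟨g, hg'⟩ := g
  have hg : g ∈ ((context F).proVal T₀.ext).decomp v := by rw [hdec]; exact hg'
  have hαg' : α.hom.arith g ∈ T₀.V.decomp (ψV w) := (hmem g).mp hg'
  have hαg : α.hom.arith g ∈ ((context F).proVal T₀.ext).decomp w := by rw [hdec]; exact hαg'
  refine CommRingCat.hom_ext (RingHom.ext fun m => ?_)
  change ψw.hom.hom (τ • ψv.inv.hom ((actNon ⟨ψV v, hv⟩ ⟨g, hg'⟩).hom.hom m)) =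
    (actNon ⟨ψV w, hw⟩ ⟨α.hom.arith g, hαg'⟩).hom.hom (ψw.hom.hom (τ • ψv.inv.hom m))
  rw [iso_inv_conj ψv _ _ (hbv g hg hg'), fieldLocAct_hom_apply]
  change ψw.hom.hom (τ • ratChart T₀.ext g • ψv.inv.hom m) = _
  rw [conjugator_smul_field α.hom hα g]
  exact iso_hom_conj ψw _ _ (hbw (α.hom.arith g) hαg hαg') (τ • ψv.inv.hom m)

/-- **Archimedean transport.**  Same setting, with Aut-holomorphic `TF`-data `(X_v ↶κ M_v)` (`κ_v : M_v ↪ A_{X_v}`) whose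
reference isomorphisms satisfy condition (c) of Def 5.1 (v) (`κ = j_A ∘ κ_{ell} ∘ ψ⁻¹` for an isomorphism `j` of the stub
orbispaces): the pairs at `ψ_V(v)` and `ψ_V(w)`, `w = V⊚(α)(v) = τ_α • v`, are identified through `ψ_v⁻¹ ≫ (τ_α ·) ≫ ψ_w` and the
orbispace isomorphism `j_v⁻¹ ≫ (C on A = ℂ) ≫ j_w`, where `C ∈ {id, conj}` matches the embeddings chosen under `v` and `τ_α • v`.
[cite: MochizukiAbsTopIII2015, Def 5.1 (vi) p.118] -/
theorem exists_archIso_kummerIso_of_mapProVal_eq (T₀ : GlobalGaloisTheater (context F))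
    (ψV : ((context F).proVal T₀.ext).carrier ≃ₜ T₀.V.carrier) (hψV : T₀.IsReferenceIso ψV)
    (harc : ∀ v : ((context F).proVal T₀.ext).arc, ψV v ∈ T₀.V.arc)
    (Marc : T₀.V.arc → CommRingCat.{0}) (kummer : ∀ v : T₀.V.arc, (Marc v →+* (T₀.X v).fieldA))
    (ψarc : ∀ v : ((context F).proVal T₀.ext).arc, (CommRingCat.of (AlgebraicClosure ℚ) : CommRingCat.{0}) ≅ Marc ⟨ψV v, harc v⟩)
    (hc : ∀ v : ((context F).proVal T₀.ext).arc, ∃ j : AutHolOrbispace.Iso (contextArchSpace T₀.ext v) (T₀.X ⟨ψV v, harc v⟩),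
      kummerTransportTF j (ψarc v) (contextKappa T₀.ext v) = kummer ⟨ψV v, harc v⟩)
    (α : T₀.ext ≅ T₀.ext) (hα : IsEAHom α.hom) (v w : ((context F).proVal T₀.ext).carrier)
    (hvw : (context F).mapProVal α.hom hα v = w) (hv : ψV v ∈ T₀.V.arc) (hw : ψV w ∈ T₀.V.arc) :
    ∃ (x : AutHolOrbispace.Iso (T₀.X ⟨ψV v, hv⟩) (T₀.X ⟨ψV w, hw⟩)) (φ : Marc ⟨ψV v, hv⟩ ≅ Marc ⟨ψV w, hw⟩),
      kummerTransportTF x φ (kummer ⟨ψV v, hv⟩) = kummer ⟨ψV w, hw⟩ := by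
  letI := (NumberField.valuationProSet ℚ).action
  have harc_of : ∀ {u : ((context F).proVal T₀.ext).carrier}, ψV u ∈ T₀.V.arc →
      u ∈ ((context F).proVal T₀.ext).arc := fun {u} hu => by
    have h : ψV u ∈ ψV '' ((context F).proVal T₀.ext).arc := by rw [hψV.2.2.2.1]; exact hu
    obtain ⟨u', hu', he⟩ := h
    rwa [← ψV.injective he]
  have hva : v ∈ ((context F).proVal T₀.ext).arc := harc_of hv
  have hwa : w ∈ ((context F).proVal T₀.ext).arc := harc_of hw
  obtain ⟨jv, hkv⟩ := hc ⟨v, hva⟩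
  obtain ⟨jw, hkw⟩ := hc ⟨w, hwa⟩
  let τ : absoluteGaloisGroup ℚ := conjugator α.hom hα
  -- `w = τ_α • v`; the embeddings under `v` and `w` correspond under `τ_α` up to `C`
  have hτw : ((⟨w, hwa⟩ : (contextProVal T₀.ext).arc).1 : (NumberField.valuationProSet ℚ).carrier) =
      τ • (show (NumberField.valuationProSet ℚ).carrier from v) := by
    rw [← context_mapProVal_apply F α.hom hα v]
    exact hvw.symm
  obtain ⟨C, hC⟩ := exists_ringEquiv_contextKappa_smul (E₁ := T₀.ext) (E₂ := T₀.ext) τ ⟨v, hva⟩ ⟨w, hwa⟩ hτw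
  let ψv : (CommRingCat.of (AlgebraicClosure ℚ) : CommRingCat.{0}) ≅ Marc ⟨ψV v, hv⟩ := ψarc ⟨v, hva⟩
  let ψw : (CommRingCat.of (AlgebraicClosure ℚ) : CommRingCat.{0}) ≅ Marc ⟨ψV w, hw⟩ := ψarc ⟨w, hwa⟩
  have hkumv : ∀ m, kummer ⟨ψV v, hv⟩ m = jv.fieldIso (contextKappa T₀.ext ⟨v, hva⟩ (ψv.inv.hom m)) :=
    fun m => (congrArg (fun k => k m) hkv).symm
  have hkumw : ∀ m, kummer ⟨ψV w, hw⟩ m = jw.fieldIso (contextKappa T₀.ext ⟨w, hwa⟩ (ψw.inv.hom m)) :=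
    fun m => (congrArg (fun k => k m) hkw).symm
  refine ⟨⟨jv.toHomeomorph.symm.trans jw.toHomeomorph, jv.fieldIso.symm.trans (C.trans jw.fieldIso),
      jv.pi1Iso.symm.trans jw.pi1Iso⟩, ψv.symm ≪≫ fieldAutHom τ ≪≫ ψw, ?_⟩
  refine RingHom.ext fun n => ?_
  rw [kummerTransportTF_apply, hkumv, hkumw]
  change jw.fieldIso (C (jv.fieldIso.symm (jv.fieldIso (contextKappa T₀.ext ⟨v, hva⟩
      (ψv.inv.hom (ψv.hom.hom ((fieldAutHom τ).inv.hom (ψw.inv.hom n)))))))) =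
    jw.fieldIso (contextKappa T₀.ext ⟨w, hwa⟩ (ψw.inv.hom n))
  rw [iso_inv_hom_apply ψv, fieldAutHom_inv_apply, RingEquiv.symm_apply_apply, ← hC, smul_inv_smul]

/-! ### F-3085 at every `TF`-shadow vocabulary -/

/-- **Def 5.1 (vi) / Cor 5.2 (vi), object part (F-3085 `PanalocalTPairExists`), PROVED at every `TF`-shadow vocabulary over
`NumberFieldShadow.context F`**: every global `TF`-pair `M⊚` has a panalocalization `{M⊚}✠` — the panalocal `TF`-pair over the
panalocal Galois-theater `V⊚(Π_E)/Aut(Π_E)` (`Π_v`, `X_v` and the local `TF`-pair data those of `M⊚` at a chosen lift of each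
class), identified with the data of `M⊚` at EVERY lift `ṽ' = α · ṽ` through `ψ_{ṽ'}⁻¹ ≫ (τ_α ·) ≫ ψ_ṽ` along `g ↦ α(g)`
(nonarchimedean: reference condition (b) and the chart-transition law; archimedean: reference condition (c), the orbispace
isomorphism acting on `A = ℂ` by the identity or complex conjugation).  The MLF-Galois-pair predicate `P` is never read.
[cite: MochizukiAbsTopIII2015, Cor 5.2 (vi) p.120] -/
theorem panalocalTPairExists_fieldShadowWith
    (P : ∀ {D : ProfiniteGrp.{0}} {M : CommRingCat.{0}}, (D →* Aut M) → Prop) :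
    PanalocalTPairExists ({ fieldShadowVocabulary F with IsMLFGaloisPair := fun {_} {_} act => P act } :
      TPairVocabulary (context F) .TF) := by
  intro M
  letI := (NumberField.valuationProSet ℚ).action
  obtain ⟨ψV, hψV, hnon, harc, ψ, ψnon, ψarc, -, hb, hc, -, -⟩ := M.exists_reference
  have hadm : IsAdmissible F M.theater.ext := M.theater.isAdmissible
  -- decomposition groups and local elements along the reference isomorphism `ψ_V`
  have hdec : ∀ u : ((context F).proVal M.theater.ext).carrier,
      ((context F).proVal M.theater.ext).decomp u = M.theater.V.decomp (ψV u) := fun u => by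
    ext g
    simp only [GaloisProSet.decomp, MulAction.mem_stabilizer_iff]
    rw [← hψV.1, ψV.injective.eq_iff]
  /- (1) THE PANALOCAL GALOIS-THEATER `V⊚(Π_E)/Aut(Π_E)` with the groups / orbispaces of `M⊚` at chosen lifts -/
  have hgenE : ∀ (α : M.theater.ext ≅ M.theater.ext) (hα : IsEAHom α.hom),
      (context F).mapProVal α.hom hα ((context F).proVal M.theater.ext).generic =
        ((context F).proVal M.theater.ext).generic := fun α hα => contextMapProVal_generic α.hom hα
  have hnonE : ∀ (α : M.theater.ext ≅ M.theater.ext) (hα : IsEAHom α.hom)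
      (v : ((context F).proVal M.theater.ext).carrier), v ∈ ((context F).proVal M.theater.ext).non →
        (context F).mapProVal α.hom hα v ∈ ((context F).proVal M.theater.ext).non :=
    fun α hα v hv => contextMapProVal_mem_non α.hom hα v hv
  have harcE : ∀ (α : M.theater.ext ≅ M.theater.ext) (hα : IsEAHom α.hom)
      (v : ((context F).proVal M.theater.ext).carrier), v ∈ ((context F).proVal M.theater.ext).arc →
        (context F).mapProVal α.hom hα v ∈ ((context F).proVal M.theater.ext).arc :=
    fun α hα v hv => contextMapProVal_mem_arc α.hom hα v hv
  have hn : ∀ q : ↥((context F).toModAut M.theater.ext '' ((context F).proVal M.theater.ext).non),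
      ∃ vl, vl ∈ ((context F).proVal M.theater.ext).non ∧ (context F).toModAut M.theater.ext vl = q.1 :=
    fun q => q.2
  have har : ∀ q : ↥((context F).toModAut M.theater.ext '' ((context F).proVal M.theater.ext).arc),
      ∃ vl : ((context F).proVal M.theater.ext).arc, (context F).toModAut M.theater.ext vl.1 = q.1 := fun q => by
    obtain ⟨vl, hvl, hq⟩ := q.2
    exact ⟨⟨vl, hvl⟩, hq⟩
  choose ln hln_mem hln_eq using hn
  choose la hla_eq using har
  have hlnV : ∀ q, ψV (ln q) ∈ M.theater.V.non := fun q => hnon ⟨ln q, hln_mem q⟩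
  have hlaV : ∀ q, ψV (la q).1 ∈ M.theater.V.arc := fun q => harc (la q)
  have href : IsPanalocalReferenceFor (context F) ((context F).toModAut M.theater.ext
      ((context F).proVal M.theater.ext).generic)
      ((context F).toModAut M.theater.ext '' ((context F).proVal M.theater.ext).non)
      ((context F).toModAut M.theater.ext '' ((context F).proVal M.theater.ext).arc)
      (fun q => M.theater.V.decompGrp (ψV (ln q))) (fun q => M.theater.X ⟨ψV (la q).1, hlaV q⟩)
      M.theater.ext (Equiv.refl _) := by
    refine ⟨rfl, fun v hv => Set.mem_image_of_mem _ hv, fun v hv => Set.mem_image_of_mem _ hv,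
      fun q => ⟨ln q, hln_mem q, hln_eq q, ?_⟩, fun q => ⟨la q, hla_eq q, ?_⟩⟩
    · exact nonempty_continuousMulEquiv_ofClosedSubgroup_of_eq _ _ (hdec (ln q)).symm
    · obtain ⟨j, -⟩ := hψV.2.2.2.2 (la q) (hlaV q)
      exact ⟨⟨j.toHomeomorph.symm, j.fieldIso.symm, j.pi1Iso.symm⟩⟩
  let T : PanalocalGaloisTheater (context F) :=
    { V := (context F).ProValModAut M.theater.ext
      generic := (context F).toModAut M.theater.ext ((context F).proVal M.theater.ext).generic
      non := (context F).toModAut M.theater.ext '' ((context F).proVal M.theater.ext).non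
      arc := (context F).toModAut M.theater.ext '' ((context F).proVal M.theater.ext).arc
      generic_notMem_non := GlobalAnabelianContext.toModAut_generic_notMem_image_non hgenE hnonE harcE
      generic_notMem_arc := GlobalAnabelianContext.toModAut_generic_notMem_image_arc hgenE hnonE harcE
      disjoint_non_arc := GlobalAnabelianContext.disjoint_image_non_image_arc hgenE hnonE harcE
      eq_generic_or_mem := (context F).eq_toModAut_generic_or_mem_image
      grp := fun q => M.theater.V.decompGrp (ψV (ln q))
      X := fun q => M.theater.X ⟨ψV (la q).1, hlaV q⟩
      exists_reference := ⟨M.theater.ext, hadm, Equiv.refl _, href⟩ }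
  /- (2) THE PANALOCAL `TF`-PAIR `{M⊚}✠`; the identifications at arbitrary lifts by the transport lemmas -/
  have clauseNon : ∀ (vl : ((context F).proVal M.theater.ext).carrier) (hvl : ψV vl ∈ M.theater.V.non)
      (hq : (Equiv.refl _) ((context F).toModAut M.theater.ext vl) ∈
        (context F).toModAut M.theater.ext '' ((context F).proVal M.theater.ext).non),
      ∃ (e : M.theater.V.decompGrp (ψV vl) ≃ₜ* M.theater.V.decompGrp (ψV (ln ⟨_, hq⟩)))
        (φ : M.Mnon ⟨ψV vl, hvl⟩ ≅ M.Mnon ⟨ψV (ln ⟨_, hq⟩), hlnV ⟨_, hq⟩⟩),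
        ∀ g, (M.actNon ⟨ψV vl, hvl⟩ g).hom ≫ φ.hom =
          φ.hom ≫ (M.actNon ⟨ψV (ln ⟨_, hq⟩), hlnV ⟨_, hq⟩⟩ (e g)).hom := by
    intro vl hvl hq
    have heq : (context F).toModAut M.theater.ext vl = (context F).toModAut M.theater.ext (ln ⟨_, hq⟩) :=
      (hln_eq ⟨_, hq⟩).symm
    obtain ⟨α, hα, hαv⟩ := exists_iso_mapProVal_eq_of_toModAut_eq F heq
    exact exists_decompGrpIso_actIso_of_mapProVal_eq F M.theater ψV hψV hnon M.Mnon M.actNon ψnon hb α hα vl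
      (ln ⟨_, hq⟩) hαv hvl (hlnV ⟨_, hq⟩)
  have clauseArc : ∀ (vl : ((context F).proVal M.theater.ext).carrier) (hvl : ψV vl ∈ M.theater.V.arc)
      (hq : (Equiv.refl _) ((context F).toModAut M.theater.ext vl) ∈
        (context F).toModAut M.theater.ext '' ((context F).proVal M.theater.ext).arc),
      ∃ (x : AutHolOrbispace.Iso (M.theater.X ⟨ψV vl, hvl⟩) (M.theater.X ⟨ψV (la ⟨_, hq⟩).1, hlaV ⟨_, hq⟩⟩))
        (φ : M.Marc ⟨ψV vl, hvl⟩ ≅ M.Marc ⟨ψV (la ⟨_, hq⟩).1, hlaV ⟨_, hq⟩⟩),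
        ({ fieldShadowVocabulary F with IsMLFGaloisPair := fun {_} {_} act => P act } :
          TPairVocabulary (context F) .TF).kummerTransport x φ (M.kummer ⟨ψV vl, hvl⟩) =
          M.kummer ⟨ψV (la ⟨_, hq⟩).1, hlaV ⟨_, hq⟩⟩ := by
    intro vl hvl hq
    have heq : (context F).toModAut M.theater.ext vl = (context F).toModAut M.theater.ext (la ⟨_, hq⟩).1 :=
      (hla_eq ⟨_, hq⟩).symm
    obtain ⟨α, hα, hαv⟩ := exists_iso_mapProVal_eq_of_toModAut_eq F heq
    exact exists_archIso_kummerIso_of_mapProVal_eq F M.theater ψV hψV harc M.Marc M.kummer ψarc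
      (fun u => by obtain ⟨j, -, -, hj⟩ := hc u; exact ⟨j, hj⟩) α hα vl (la ⟨_, hq⟩).1 hαv hvl (hlaV ⟨_, hq⟩)
  exact ⟨{ theater := T
           data :=
             { Mnon := fun q => M.Mnon ⟨ψV (ln q), hlnV q⟩
               actNon := fun q => M.actNon ⟨ψV (ln q), hlnV q⟩
               isMLF := fun q => M.isMLF ⟨ψV (ln q), hlnV q⟩
               Marc := fun q => M.Marc ⟨ψV (la q).1, hlaV q⟩
               kummer := fun q => M.kummer ⟨ψV (la q).1, hlaV q⟩
               isAutHol := fun q => M.isAutHol ⟨ψV (la q).1, hlaV q⟩ } },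
    ψV, hψV, Equiv.refl _, href, clauseNon, clauseArc⟩

/-! ### Corollaries: the two `TF`-shadow vocabularies of record -/

/-- **F-3085 at the `TF`-shadow vocabulary `fieldShadowVocabulary F`** (p491073; group-theoretic MLF-pair predicate).
[cite: MochizukiAbsTopIII2015, Cor 5.2 (vi) p.120] -/
theorem panalocalTPairExists_fieldShadow : PanalocalTPairExists (fieldShadowVocabulary F) :=
  panalocalTPairExists_fieldShadowWith F (fun {D} {_} _ => IsMLFGaloisType D)

/-- **F-3085 at the `TF`-shadow vocabulary `fieldShadowVocabulary' F`** (p493095; print-shape MLF-pair predicate "isomorphic to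
a model pair", Def 3.1 (ii)). [cite: MochizukiAbsTopIII2015, Cor 5.2 (vi) p.120] -/
theorem panalocalTPairExists_fieldShadow' : PanalocalTPairExists (fieldShadowVocabulary' F) :=
  panalocalTPairExists_fieldShadowWith F (fun {_} {_} act => IsShadowMLFGaloisTFPair act)

end NumberFieldShadow

end Literature.AnabelianGeometry.AbsoluteAnabelian

end
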